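import Mathlib
import HarnessLib

/-!
# Splitting off one variable of a multivariate power series: `R⟦X_{Option σ}⟧ ≃+* (R⟦X_σ⟧)⟦T⟧`

`Literature/RingTheory/MvPowerSeries/OptionEquivLeft.lean`. A DEFINITION with its API, all
proofs complete. Mathlib has the polynomial version `MvPolynomial.optionEquivLeft :
MvPolynomial (Option σ) R ≃ₐ[R] Polynomial (MvPolynomial σ R)` but no power-series analogue; the
substitution API (`MvPowerSeries.subst`) does not apply, because the would-be images `X s` of the
variables `some s` are not nilpotent constants. We construct the ring isomorphism

  `optionEquivLeft : MvPowerSeries (Option σ) R ≃+* PowerSeries (MvPowerSeries σ R)`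

directly on coefficients (`coeff_coeff_optionEquivLeft`): the coefficient of `Tⁿ x^d` of the image
of `F` is the coefficient of `x^{(n, d)}` of `F`, where `(n, d) ↦ d.optionElim n` is Mathlib's
`Finsupp.optionEquiv`. Multiplicativity is the bijection between the antidiagonal of `d.optionElim n`
in `Option σ →₀ ℕ` and the product of the antidiagonals of `n` and `d`.

This is the coefficient-slicing device behind inductions on the number of variables for power
series, e.g. the induction "on the dimension `d`" for the `ℚ(p(x₁), …, p(x_d))`-linear
independence of products `∏_s f_{i_s}(x_s)` in F. Calegari, V. Dimitrov, Y. Tang, *The unbounded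
denominators conjecture* (J. Amer. Math. Soc. **38** (2025), 627–702), §2.1, end of the proof of
Lemma 2.1.1 (whose one-variable step is `Literature.RingTheory.PowerSeries.
linearIndependent_aeval_baseChange`). [folklore]
-/

noncomputable section

open Finset Finsupp

namespace Literature.RingTheory.MvPowerSeries

variable {σ : Type*} {R : Type*} [CommRing R]

/-! ### 1. Index bookkeeping on `Option σ →₀ ℕ` -/

/-- `(d.optionElim n).some = d`. [folklore] -/
@[simp] theorem some_optionElim (d : σ →₀ ℕ) (n : ℕ) : (d.optionElim n).some = d := by
  ext s; simp

/-- `e.some.optionElim (e none) = e`. [folklore] -/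
@[simp] theorem optionElim_some_self (e : Option σ →₀ ℕ) : (e.some).optionElim (e none) = e := by
  ext (_ | s) <;> simp

/-- `optionElim` is additive in both arguments. [folklore] -/
theorem optionElim_add (d₁ d₂ : σ →₀ ℕ) (n₁ n₂ : ℕ) :
    (d₁ + d₂).optionElim (n₁ + n₂) = d₁.optionElim n₁ + d₂.optionElim n₂ := by
  ext (_ | s) <;> simp

/-- `optionElim` is injective (jointly in both arguments). [folklore] -/
theorem optionElim_inj {d₁ d₂ : σ →₀ ℕ} {n₁ n₂ : ℕ} (h : d₁.optionElim n₁ = d₂.optionElim n₂) :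
    n₁ = n₂ ∧ d₁ = d₂ := by
  constructor
  · have h1 := congrArg (fun e : Option σ →₀ ℕ ↦ e none) h
    simpa using h1
  · have h1 := congrArg Finsupp.some h
    simpa using h1

/-! ### 2. The isomorphism -/

/-- The forward coefficient-slicing map `F ↦ ∑_n (x^d ↦ [x^{(n,d)}] F) Tⁿ`. [folklore] -/
def optionSplit (F : MvPowerSeries (Option σ) R) : PowerSeries (MvPowerSeries σ R) :=
  PowerSeries.mk fun n ↦ (fun d ↦ MvPowerSeries.coeff (d.optionElim n) F : MvPowerSeries σ R)

/-- Coefficients of `optionSplit`. [folklore] -/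
@[simp] theorem coeff_coeff_optionSplit (F : MvPowerSeries (Option σ) R) (n : ℕ) (d : σ →₀ ℕ) :
    MvPowerSeries.coeff d (PowerSeries.coeff n (optionSplit F)) =
      MvPowerSeries.coeff (d.optionElim n) F := by
  rw [optionSplit, PowerSeries.coeff_mk]; rfl

/-- The backward map `G ↦ (x^e ↦ [x^{e.some}] [T^{e none}] G)`. [folklore] -/
def optionUnsplit (G : PowerSeries (MvPowerSeries σ R)) : MvPowerSeries (Option σ) R :=
  fun e ↦ MvPowerSeries.coeff e.some (PowerSeries.coeff (e none) G)

/-- Coefficients of `optionUnsplit`. [folklore] -/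
@[simp] theorem coeff_optionUnsplit (G : PowerSeries (MvPowerSeries σ R)) (e : Option σ →₀ ℕ) :
    MvPowerSeries.coeff e (optionUnsplit G) =
      MvPowerSeries.coeff e.some (PowerSeries.coeff (e none) G) := rfl

/-- `optionSplit` is multiplicative: the antidiagonal of `d.optionElim n` in `Option σ →₀ ℕ` is in
bijection with the product of the antidiagonals of `n` and `d`. [folklore] -/
theorem optionSplit_mul (F G : MvPowerSeries (Option σ) R) :
    optionSplit (F * G) = optionSplit F * optionSplit G := by
  classical
  ext n d
  rw [coeff_coeff_optionSplit, PowerSeries.coeff_mul, map_sum, MvPowerSeries.coeff_mul]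
  simp_rw [MvPowerSeries.coeff_mul, coeff_coeff_optionSplit]
  rw [← Finset.sum_product (antidiagonal n) (antidiagonal d)
    (fun y ↦ MvPowerSeries.coeff (y.2.1.optionElim y.1.1) F *
      MvPowerSeries.coeff (y.2.2.optionElim y.1.2) G)]
  refine Finset.sum_nbij' (fun p ↦ ((p.1 none, p.2 none), (p.1.some, p.2.some)))
    (fun y ↦ (y.2.1.optionElim y.1.1, y.2.2.optionElim y.1.2)) ?_ ?_ ?_ ?_ ?_
  · rintro ⟨e₁, e₂⟩ he
    rw [HasAntidiagonal.mem_antidiagonal] at he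
    simp only [mem_product, HasAntidiagonal.mem_antidiagonal]
    constructor
    · have h1 := congrArg (fun e : Option σ →₀ ℕ ↦ e none) he
      simpa using h1
    · rw [← Finsupp.some_add, he, some_optionElim]
  · rintro ⟨⟨n₁, n₂⟩, ⟨d₁, d₂⟩⟩ hy
    simp only [mem_product, HasAntidiagonal.mem_antidiagonal] at hy
    rw [HasAntidiagonal.mem_antidiagonal]
    change d₁.optionElim n₁ + d₂.optionElim n₂ = d.optionElim n
    rw [← optionElim_add, hy.1, hy.2]
  · rintro ⟨e₁, e₂⟩ _
    simp only [optionElim_some_self]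
  · rintro ⟨⟨n₁, n₂⟩, ⟨d₁, d₂⟩⟩ _
    simp only [some_optionElim, Finsupp.optionElim_apply_none]
  · rintro ⟨e₁, e₂⟩ _
    simp only [optionElim_some_self]

/-- **Splitting off the variable `none`**: the ring isomorphism
`MvPowerSeries (Option σ) R ≃+* PowerSeries (MvPowerSeries σ R)` sending `F` to the power series
in `T` whose `Tⁿ`-coefficient is the `σ`-variable power series `x^d ↦ [x^{(n,d)}] F`.
[folklore] -/
def optionEquivLeft : MvPowerSeries (Option σ) R ≃+* PowerSeries (MvPowerSeries σ R) where
  toFun := optionSplit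
  invFun := optionUnsplit
  left_inv F := by
    ext e
    rw [coeff_optionUnsplit, coeff_coeff_optionSplit, optionElim_some_self]
  right_inv G := by
    ext n d
    rw [coeff_coeff_optionSplit, coeff_optionUnsplit, some_optionElim, Finsupp.optionElim_apply_none]
  map_add' F G := by
    ext n d
    rw [map_add, map_add, coeff_coeff_optionSplit, coeff_coeff_optionSplit, coeff_coeff_optionSplit, map_add]
  map_mul' := optionSplit_mul

/-- **Coefficients of the splitting**: `[x^d] ([Tⁿ] optionEquivLeft F) = [x^{(n,d)}] F`.
[folklore] -/
@[simp] theorem coeff_coeff_optionEquivLeft (F : MvPowerSeries (Option σ) R) (n : ℕ) (d : σ →₀ ℕ) :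
    MvPowerSeries.coeff d (PowerSeries.coeff n (optionEquivLeft F)) =
      MvPowerSeries.coeff (d.optionElim n) F :=
  coeff_coeff_optionSplit F n d

/-- Coefficients of the inverse: `[x^e] (optionEquivLeft⁻¹ G) = [x^{e.some}] ([T^{e none}] G)`.
[folklore] -/
@[simp] theorem coeff_optionEquivLeft_symm (G : PowerSeries (MvPowerSeries σ R))
    (e : Option σ →₀ ℕ) :
    MvPowerSeries.coeff e (optionEquivLeft.symm G) =
      MvPowerSeries.coeff e.some (PowerSeries.coeff (e none) G) := rfl

/-! ### 3. Images of the generators -/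

/-- The variable `none` goes to `T`. [folklore] -/
theorem optionEquivLeft_X_none :
    optionEquivLeft (MvPowerSeries.X none : MvPowerSeries (Option σ) R) = PowerSeries.X := by
  classical
  ext n d
  rw [coeff_coeff_optionEquivLeft, MvPowerSeries.coeff_X, PowerSeries.coeff_X]
  by_cases hn : n = 1
  · subst hn
    rw [if_pos rfl]
    by_cases hd : d = 0
    · subst hd
      rw [MvPowerSeries.coeff_one, if_pos rfl, if_pos]
      ext (_ | s) <;> simp
    · rw [MvPowerSeries.coeff_one, if_neg hd, if_neg]
      intro h
      apply hd
      have h1 := congrArg Finsupp.some h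
      rw [some_optionElim] at h1
      rw [h1]; ext s; simp
  · rw [if_neg hn, if_neg, MvPowerSeries.coeff_zero]
    intro h
    apply hn
    have h1 := congrArg (fun e : Option σ →₀ ℕ ↦ e none) h
    simpa using h1

/-- A variable `some s` goes to the constant power series `X s`. [folklore] -/
theorem optionEquivLeft_X_some (s : σ) :
    optionEquivLeft (MvPowerSeries.X (some s) : MvPowerSeries (Option σ) R) =
      PowerSeries.C (MvPowerSeries.X s) := by
  classical
  ext n d
  rw [coeff_coeff_optionEquivLeft, MvPowerSeries.coeff_X, PowerSeries.coeff_C]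
  by_cases hn : n = 0
  · subst hn
    rw [if_pos rfl, MvPowerSeries.coeff_X]
    congr 1
    apply propext
    constructor
    · intro h
      have h1 := congrArg Finsupp.some h
      rw [some_optionElim] at h1
      rw [h1]; ext t; simp [Finsupp.single_apply]
    · intro h
      rw [h]; ext (_ | t) <;> simp [Finsupp.single_apply]
  · rw [if_neg hn, MvPowerSeries.coeff_zero, if_neg]
    intro h
    apply hn
    have h1 := congrArg (fun e : Option σ →₀ ℕ ↦ e none) h
    simpa using h1

/-- Constants go to constants. [folklore] -/
theorem optionEquivLeft_C (r : R) :
    optionEquivLeft (MvPowerSeries.C r : MvPowerSeries (Option σ) R) =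
      PowerSeries.C (MvPowerSeries.C r) := by
  classical
  ext n d
  rw [coeff_coeff_optionEquivLeft, MvPowerSeries.coeff_C, PowerSeries.coeff_C]
  by_cases hn : n = 0
  · subst hn
    rw [if_pos rfl, MvPowerSeries.coeff_C]
    congr 1
    apply propext
    constructor
    · intro h
      have h1 := congrArg Finsupp.some h
      rw [some_optionElim] at h1
      rw [h1]; ext t; simp
    · intro h; rw [h]; ext (_ | t) <;> simp
  · rw [if_neg hn, MvPowerSeries.coeff_zero, if_neg]
    intro h
    apply hn
    have h1 := congrArg (fun e : Option σ →₀ ℕ ↦ e none) h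
    simpa using h1

/-! ### 4. Interaction with one-variable power series placed in a given variable -/

/-- Coefficients of `g.toMvPowerSeries i` (the one-variable power series `g` in the variable
`i`): the coefficient of `x^d` is `[Tⁿ] g` if `d = n · e_i` and `0` otherwise. [folklore] -/
theorem coeff_toMvPowerSeries {τ : Type*} [DecidableEq τ] (g : PowerSeries R)
    (i : τ) (d : τ →₀ ℕ) :
    MvPowerSeries.coeff d (g.toMvPowerSeries i) =
      if d = Finsupp.single i (d i) then PowerSeries.coeff (d i) g else 0 := by
  rw [PowerSeries.toMvPowerSeries_eq_subst, PowerSeries.coeff_subst (PowerSeries.HasSubst.X i)]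
  rw [finsum_eq_single (a := d i)]
  · rw [MvPowerSeries.coeff_X_pow, smul_eq_mul, mul_ite, mul_one, mul_zero]
  · intro n hn
    rw [MvPowerSeries.coeff_X_pow, smul_eq_mul, mul_ite, mul_one, mul_zero, if_neg]
    intro hd
    apply hn
    rw [hd, Finsupp.single_eq_same]

/-- A power series in the split-off variable `none` goes to the same power series with constant
coefficients: `optionEquivLeft (g(x_none)) = ∑ₙ C([Tⁿ] g) Tⁿ`. [folklore] -/
theorem optionEquivLeft_toMvPowerSeries_none [DecidableEq σ] (g : PowerSeries R) :
    optionEquivLeft (g.toMvPowerSeries none : MvPowerSeries (Option σ) R) =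
      PowerSeries.map (MvPowerSeries.C) g := by
  classical
  ext n d
  rw [coeff_coeff_optionEquivLeft, coeff_toMvPowerSeries, PowerSeries.coeff_map,
    MvPowerSeries.coeff_C, Finsupp.optionElim_apply_none]
  by_cases hd : d = 0
  · subst hd
    rw [if_pos rfl, if_pos]
    ext (_ | s) <;> simp
  · rw [if_neg hd, if_neg]
    intro h
    apply hd
    ext s
    have h1 := congrArg (fun e : Option σ →₀ ℕ ↦ e (some s)) h
    simpa using h1

/-- A power series in another variable `some s` goes to a constant:
`optionEquivLeft (g(x_{some s})) = C (g(x_s))`. [folklore] -/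
theorem optionEquivLeft_toMvPowerSeries_some [DecidableEq σ] (g : PowerSeries R) (s : σ) :
    optionEquivLeft (g.toMvPowerSeries (some s) : MvPowerSeries (Option σ) R) =
      PowerSeries.C (g.toMvPowerSeries s) := by
  classical
  ext n d
  rw [coeff_coeff_optionEquivLeft, coeff_toMvPowerSeries, PowerSeries.coeff_C,
    Finsupp.optionElim_apply_some]
  by_cases hn : n = 0
  · subst hn
    rw [if_pos rfl, coeff_toMvPowerSeries]
    congr 1
    apply propext
    constructor
    · intro h
      have h1 := congrArg Finsupp.some h
      rw [some_optionElim] at h1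
      rw [h1]; ext t; simp [Finsupp.single_apply]
    · intro h
      conv_lhs => rw [h]
      ext (_ | t)
      · simp
      · simp [Finsupp.single_apply]
  · rw [if_neg hn, map_zero, if_neg]
    intro h
    apply hn
    have h1 := congrArg (fun e : Option σ →₀ ℕ ↦ e none) h
    simpa using h1

end Literature.RingTheory.MvPowerSeries
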